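import Summits.CriticalPhenomena.CardyFormulaZ2.Theorems.CardyBoundaryCoulombGasHalfPlaneMarkDensityLawNoFreeConstant
import Summits.CriticalPhenomena.CardyFormulaZ2.Theorems.CardyBoundaryCoulombGasHalfPlaneMarkDensityLawIdentification

/-!
# `HalfPlaneMarkDensityLaw` (crux stmt-CriticalPhenomena-5661), line `Sketch`, proportionality (P1):
# stub `stub_prop_gapFunction` — proportionality to `F∘η` in the fourth mark forces a gap function

`P_n(a,b,c,y) = P_{1/2}[[⌊an⌋,⌊bn⌋]×{0} ↔ [⌊cn⌋,⌊yn⌋]×{0} in ℤ×ℕ]`, chamber `a < b < c < y`, and `G` a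
joint subsequential limit of `P_{θ n}` along a strictly increasing `θ`; `F` is Cardy's function and
`η(a,b,c,y) = crossRatio ![a,b,c,y]` the cross-ratio of the four marks.

**Claim.** If for every `a < b < c` the function `y ↦ G(a,b,c,y)` is proportional to `y ↦ F(η(a,b,c,y))`
on `(c, ∞)`, then the proportionality factor is a continuous function of the gap `c − b` alone:
`G(a,b,c,y) = m(c − b) · F(η(a,b,c,y))` with `m` continuous on `(0, ∞)`.

**Proof.** `F∘η > 0` on the chamber (`η ∈ (0,1)`, `F` strictly increasing from `F(0) = 0`), so the
factor is determined, `m(a,b,c) = G(a,b,c,c+1) / F(η(a,b,c,c+1))`.  Reflection symmetry of the joint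
limits, `G(−y,−c,−b,−a) = G(a,b,c,y)` (`Subseq.reflect_of_jointLimit`), and reflection invariance of
the cross-ratio give `m(−y,−c,−b) = m(a,b,c)` for all `a < b < c < y`; the left side does not see `a`,
so `m` does not depend on its first argument.  Translation invariance (`Subseq.translate_of_jointLimit`)
gives `m(a+t,b+t,c+t) = m(a,b,c)`, whence `m(a,b,c) = m(a−b,0,c−b) = m(−1,0,c−b)`.  Finally
`g ↦ m(−1,0,g) = G(−1,0,g,g+1) / F(η(−1,0,g,g+1))` is continuous on `(0,∞)`: the numerator by the joint
continuity of `G` on the chamber (`Subseq.continuousOn_of_jointLimit`), the denominator because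
`η(−1,0,g,g+1) = 1/(1+g)²` is continuous with values in `[0,1]`, where `F` is continuous, and nonzero.
-/

noncomputable section

namespace Summit.CriticalPhenomena.CardyFormulaZ2.Cruxes.HalfPlaneMarkDensityLaw.SketchLine

open Literature.Probability.Percolation Literature.Probability.LatticeModels
open Literature.Probability.RandomPlanarGeometry (crossRatio)
open MeasureTheory Filter Set
open scoped Topology
open Summit.CriticalPhenomena.CardyFormulaZ2.Theorems.HalfPlaneMarkDensityLaw.Negative

namespace Proportional

/-- Reflection `x ↦ −x` reverses the four marks and preserves their cross-ratio:
`η(−y,−c,−b,−a) = η(a,b,c,y)`. [folklore] -/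
theorem crossRatio_four_reflect (a b c y : ℝ) :
    crossRatio ![-y, -c, -b, -a] = crossRatio ![a, b, c, y] := by
  rw [crossRatio_four, crossRatio_four]
  ring

/-- Simultaneous translation of the four marks preserves their cross-ratio:
`η(a+t,b+t,c+t,y+t) = η(a,b,c,y)`. [folklore] -/
theorem crossRatio_four_translate (a b c y t : ℝ) :
    crossRatio ![a + t, b + t, c + t, y + t] = crossRatio ![a, b, c, y] := by
  rw [crossRatio_four, crossRatio_four]
  ring

/-- The cross-ratio of the normalised marks `(−1, 0, g, g+1)` is `1/(1+g)²`. [folklore] -/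
theorem crossRatio_four_normal (g : ℝ) : crossRatio ![-1, 0, g, g + 1] = 1 / (1 + g) ^ 2 := by
  rw [crossRatio_four, show ((-1 : ℝ) - 0) * (g - (g + 1)) = 1 by ring,
    show ((-1 : ℝ) - g) * (0 - (g + 1)) = (1 + g) ^ 2 by ring]

/-- `F∘η > 0` on the chamber `a < b < c < y` (`η ∈ (0,1)`, `F` strictly increasing, `F(0) = 0`).
[folklore] -/
theorem cardy_crossRatio_four_pos {a b c y : ℝ} (hab : a < b) (hbc : b < c) (hcy : c < y) :
    0 < Literature.Probability.RandomPlanarGeometry.cardyFunction (crossRatio ![a, b, c, y]) :=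
  cardyFunction_pos_of_mem_Ioo (crossRatio_four_mem_Ioo hab hbc hcy)

/-- `g ↦ F(η(−1,0,g,g+1))` is continuous on `(0, ∞)`. [folklore] -/
theorem continuousOn_cardy_crossRatio_normal :
    ContinuousOn (fun g : ℝ ↦
      Literature.Probability.RandomPlanarGeometry.cardyFunction (crossRatio ![-1, 0, g, g + 1]))
      (Ioi 0) := by
  have h1 : ContinuousOn (fun g : ℝ ↦ crossRatio ![-1, 0, g, g + 1]) (Ioi 0) := by
    simp_rw [crossRatio_four_normal]
    refine ContinuousOn.div₀ continuousOn_const (by fun_prop) fun g hg ↦ ?_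
    have hg0 : (0 : ℝ) < g := hg
    positivity
  refine Literature.Probability.RandomPlanarGeometry.continuousOn_cardyFunction_holds.comp h1
    fun g hg ↦ ?_
  exact crossRatio_four_mem_Icc (by norm_num) hg (by linarith)

/-- **Joint continuity along the normalised diagonal**: `g ↦ G(−1,0,g,g+1)` is continuous on
`(0, ∞)` for a joint subsequential limit `G` along a strictly increasing `θ`. [folklore] -/
theorem continuousOn_jointLimit_normal {θ : ℕ → ℕ} {G : ℝ → ℝ → ℝ → ℝ → ℝ}
    (hG : ∀ a b c y : ℝ, a < b → b < c → c < y →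
      Tendsto (fun n ↦ μ.real (openCrossing halfPlane (arcA a b (θ n))
        (rowIcc ⌊c * (θ n : ℕ)⌋ ⌊y * (θ n : ℕ)⌋))) atTop (𝓝 (G a b c y)))
    (hθ : StrictMono θ) :
    ContinuousOn (fun g : ℝ ↦ G (-1) 0 g (g + 1)) (Ioi 0) := by
  have hc := Subseq.continuousOn_of_jointLimit hG hθ
  have hφ : Continuous (fun g : ℝ ↦ ((-1 : ℝ), (0 : ℝ), g, g + 1)) := by fun_prop
  refine hc.comp hφ.continuousOn fun g hg ↦ ?_
  have hg0 : (0 : ℝ) < g := hg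
  simp only [Set.mem_setOf_eq]
  exact ⟨by norm_num, hg0, by linarith⟩

/-- STUB P1: proportionality in the fourth mark forces a factor depending on the gap `c − b` only, continuously. [folklore] -/
theorem stub_prop_gapFunction :
    ∀ {θ : ℕ → ℕ} {G : ℝ → ℝ → ℝ → ℝ → ℝ},
      (∀ a b c y : ℝ, a < b → b < c → c < y →
        Tendsto (fun n ↦ μ.real (openCrossing halfPlane (arcA a b (θ n))
          (rowIcc ⌊c * (θ n : ℕ)⌋ ⌊y * (θ n : ℕ)⌋))) atTop (𝓝 (G a b c y))) →
      StrictMono θ → (∀ a b c : ℝ, a < b → b < c → ∃ m : ℝ, ∀ y : ℝ, c < y → G a b c y = m * Literature.Probability.RandomPlanarGeometry.cardyFunction (crossRatio ![a, b, c, y])) →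
      ∃ mfun : ℝ → ℝ, ContinuousOn mfun (Set.Ioi 0) ∧
        (∀ a b c y : ℝ, a < b → b < c → c < y → G a b c y = mfun (c - b) * Literature.Probability.RandomPlanarGeometry.cardyFunction (crossRatio ![a, b, c, y])) := by
  intro θ G hG hθ hprop
  -- the factor, read off at `y = c + 1`
  obtain ⟨m, hm_def⟩ : ∃ m : ℝ → ℝ → ℝ → ℝ, ∀ a b c : ℝ, m a b c = G a b c (c + 1) /
      Literature.Probability.RandomPlanarGeometry.cardyFunction (crossRatio ![a, b, c, c + 1]) :=
    ⟨fun a b c ↦ G a b c (c + 1) /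
      Literature.Probability.RandomPlanarGeometry.cardyFunction (crossRatio ![a, b, c, c + 1]),
      fun _ _ _ ↦ rfl⟩
  -- proportionality with the explicit factor `m`
  have hm : ∀ {a b c y : ℝ}, a < b → b < c → c < y → G a b c y =
      m a b c * Literature.Probability.RandomPlanarGeometry.cardyFunction (crossRatio ![a, b, c, y]) := by
    intro a b c y hab hbc hcy
    obtain ⟨m₀, hm₀⟩ := hprop a b c hab hbc
    have h1 : m a b c = m₀ := by
      rw [hm_def, hm₀ (c + 1) (lt_add_one c), mul_div_assoc,
        div_self (cardy_crossRatio_four_pos hab hbc (lt_add_one c)).ne', mul_one]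
    rw [h1]
    exact hm₀ y hcy
  -- reflection: `m(−y,−c,−b) = m(a,b,c)`
  have hrefl : ∀ {a b c y : ℝ}, a < b → b < c → c < y → m (-y) (-c) (-b) = m a b c := by
    intro a b c y hab hbc hcy
    have h1 := hm (a := -y) (b := -c) (c := -b) (y := -a) (by linarith) (by linarith)
      (by linarith)
    rw [Subseq.reflect_of_jointLimit hG hθ hab hbc hcy, crossRatio_four_reflect,
      hm hab hbc hcy] at h1
    exact (mul_right_cancel₀ (cardy_crossRatio_four_pos hab hbc hcy).ne' h1).symm
  -- hence `m` does not depend on its first argument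
  have hfirst : ∀ {a a' b c : ℝ}, a < b → a' < b → b < c → m a b c = m a' b c := by
    intro a a' b c hab ha'b hbc
    rw [← hrefl hab hbc (lt_add_one c), ← hrefl ha'b hbc (lt_add_one c)]
  -- translation: `m(a+t,b+t,c+t) = m(a,b,c)`
  have htrans : ∀ {a b c : ℝ} (t : ℝ), a < b → b < c → m (a + t) (b + t) (c + t) = m a b c := by
    intro a b c t hab hbc
    have h1 := hm (a := a + t) (b := b + t) (c := c + t) (y := c + 1 + t) (by linarith) (by linarith)
      (by linarith)
    rw [Subseq.translate_of_jointLimit hG hθ hab hbc (lt_add_one c) t, crossRatio_four_translate,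
      hm hab hbc (lt_add_one c)] at h1
    exact (mul_right_cancel₀ (cardy_crossRatio_four_pos hab hbc (lt_add_one c)).ne' h1).symm
  -- the factor is a function of the gap: `m(a,b,c) = m(−1,0,c−b)`
  have hkey : ∀ {a b c : ℝ}, a < b → b < c → m a b c = m (-1) 0 (c - b) := by
    intro a b c hab hbc
    have h1 := htrans (a := a - b) (b := 0) (c := c - b) b (by linarith) (by linarith)
    rw [sub_add_cancel, zero_add, sub_add_cancel] at h1
    rw [h1]
    exact hfirst (by linarith) (by linarith) (by linarith)
  refine ⟨fun g ↦ m (-1) 0 g, ?_, fun a b c y hab hbc hcy ↦ ?_⟩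
  · -- continuity of the gap function on `(0, ∞)`
    have h := (continuousOn_jointLimit_normal hG hθ).div₀ continuousOn_cardy_crossRatio_normal
      fun g hg ↦ (cardy_crossRatio_four_pos (by norm_num) hg (lt_add_one g)).ne'
    exact h.congr fun g _ ↦ hm_def (-1) 0 g
  · rw [hm hab hbc hcy, hkey hab hbc]

end Proportional

end Summit.CriticalPhenomena.CardyFormulaZ2.Cruxes.HalfPlaneMarkDensityLaw.SketchLine

end
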